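import Mathlib
import Literature.Computability.AlgebraicComplexity.OrbitClosure

/-!
# Crux `DetQP.DetqpSuperquadratic` (stmt-ValiantsHypothesis-0318), line
# `linear-homogenisation-transfer` — stub `stub_zariskiLimit` (B1): Zariski limits along curves

Orbit closures `Δ[f] = orbitClosure f` (the Zariski closure of the coefficient vectors of the orbit
`GL · f`, file `Literature/Computability/AlgebraicComplexity/OrbitClosure.lean`) are closed under
`t → 0` along polynomial curves in coefficient space: if
`C(t) = P₀ + t P₁ + ⋯ + t^E P_E ∈ Δ[f]` for every `t ≠ 0`, then `C(0) = P₀ ∈ Δ[f]`.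

Proof: for a test polynomial `p` (in the coefficient coordinates `σ →₀ ℕ`) vanishing on `GL · f`,
the function `t ↦ p(coeffVec (C(t)))` is the evaluation of a univariate polynomial
`Q = aeval (d ↦ Σₑ C(coeff d Pₑ) Xᵉ) p ∈ ℂ[t]`; it vanishes on the infinite set `ℂ ∖ {0}`, hence
`Q = 0`, hence `p(coeffVec P₀) = Q(0) = 0`.  (Mulmuley–Sohoni 2001 §4.1; folklore.)

In the skeleton of the line this is used with `σ = Fin m × Fin m`, `f = det_m` and the rescaled
graded homogenisation of an affine determinantal expression as the curve.
-/

-- `Summit.ValiantsHypothesis.ValiantsHypothesis.…` is the tree's mandated single-conjunct layout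
-- (Sub = Summit), so the duplicated namespace component is intended.
set_option linter.dupNamespace false

noncomputable section

open MvPolynomial
open Literature.Computability.AlgebraicComplexity

namespace Summit.ValiantsHypothesis.ValiantsHypothesis.Theorems.DetQPDetqpSuperquadratic

namespace ZariskiLimit

variable {σ : Type*}

/-- Evaluating the univariate polynomial `Σₑ C(coeff d Pₑ) Xᵉ` attached to a coefficient
coordinate `d` of the curve `t ↦ Σ_{e ≤ E} tᵉ Pₑ` at `t` gives the `d`-th coefficient of the curve
point `Σ_{e ≤ E} tᵉ Pₑ`. [folklore] -/
theorem eval_coordPoly (P : ℕ → MvPolynomial σ ℂ) (E : ℕ) (d : σ →₀ ℕ) (t : ℂ) :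
    (∑ e ∈ Finset.range (E + 1), Polynomial.C (coeff d (P e)) * Polynomial.X ^ e).eval t =
      coeffVec (∑ e ∈ Finset.range (E + 1), t ^ e • P e) d := by
  simp only [coeffVec_apply, Polynomial.eval_finsetSum, Polynomial.eval_mul,
    Polynomial.eval_C, Polynomial.eval_pow, Polynomial.eval_X, MvPolynomial.coeff_sum,
    MvPolynomial.coeff_smul, smul_eq_mul]
  refine Finset.sum_congr rfl fun e _ => ?_
  ring

/-- Pulling a test polynomial `p` in the coefficient coordinates back along the curve: the
univariate polynomial `aeval (d ↦ Σₑ C(coeff d Pₑ) Xᵉ) p` evaluates at `t` to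
`p (coeffVec (Σ tᵉ Pₑ))`. [folklore] -/
theorem eval_aeval_coordPoly (P : ℕ → MvPolynomial σ ℂ) (E : ℕ)
    (p : MvPolynomial (σ →₀ ℕ) ℂ) (t : ℂ) :
    (MvPolynomial.aeval (fun d : σ →₀ ℕ =>
        ∑ e ∈ Finset.range (E + 1), Polynomial.C (coeff d (P e)) * Polynomial.X ^ e) p).eval t =
      MvPolynomial.aeval (coeffVec (∑ e ∈ Finset.range (E + 1), t ^ e • P e)) p := by
  rw [← Polynomial.coe_aeval_eq_eval]
  change ((Polynomial.aeval t).comp (MvPolynomial.aeval fun d : σ →₀ ℕ =>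
    ∑ e ∈ Finset.range (E + 1), Polynomial.C (coeff d (P e)) * Polynomial.X ^ e)) p = _
  rw [MvPolynomial.comp_aeval]
  have hfun : (fun d : σ →₀ ℕ => Polynomial.aeval t
      (∑ e ∈ Finset.range (E + 1), Polynomial.C (coeff d (P e)) * Polynomial.X ^ e)) =
      coeffVec (∑ e ∈ Finset.range (E + 1), t ^ e • P e) :=
    funext fun d => by rw [Polynomial.coe_aeval_eq_eval, eval_coordPoly]
  rw [hfun]

/-- At `t = 0` the curve `Σ_{e ≤ E} tᵉ Pₑ` passes through `P₀`. [folklore] -/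
theorem curve_zero (P : ℕ → MvPolynomial σ ℂ) (E : ℕ) :
    (∑ e ∈ Finset.range (E + 1), (0 : ℂ) ^ e • P e) = P 0 := by
  rw [Finset.sum_eq_single_of_mem 0 (by simp)]
  · simp
  · intro e _ he
    rw [zero_pow he, zero_smul]

end ZariskiLimit

/-- Registered stub **B1** `stub_zariskiLimit` of line `linear-homogenisation-transfer`: orbit
closures are closed under `t → 0` along polynomial curves.  If `P₀ + t P₁ + ⋯ + t^E P_E ∈ Δ[f]`
for every `t ≠ 0`, then `P₀ ∈ Δ[f]`: for a test polynomial `p` vanishing on `GL · f`,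
`t ↦ p(coeffVec(Σ tᵉ Pₑ))` is a univariate polynomial vanishing on `ℂ ∖ {0}`, hence identically,
hence at `t = 0` (Mulmuley–Sohoni 2001 §4.1). [folklore] -/
theorem stub_zariskiLimit :
    ∀ (σ : Type) [Fintype σ] [DecidableEq σ] (f : MvPolynomial σ ℂ) (P : ℕ → MvPolynomial σ ℂ)
      (E : ℕ),
      (∀ t : ℂ, t ≠ 0 → (∑ e ∈ Finset.range (E + 1), t ^ e • P e) ∈ orbitClosure f) →
      P 0 ∈ orbitClosure f := by
  intro σ _ _ f P E hP
  rw [mem_orbitClosure_iff]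
  intro p hp
  -- the univariate pull-back of `p` along the curve vanishes at every `t ≠ 0`
  set Q : Polynomial ℂ := MvPolynomial.aeval (fun d : σ →₀ ℕ =>
    ∑ e ∈ Finset.range (E + 1), Polynomial.C (coeff d (P e)) * Polynomial.X ^ e) p with hQdef
  have hroot : ∀ t : ℂ, t ≠ 0 → Q.IsRoot t := by
    intro t ht
    rw [Polynomial.IsRoot.def, hQdef, ZariskiLimit.eval_aeval_coordPoly]
    exact (mem_orbitClosure_iff.1 (hP t ht)) p hp
  -- hence it is the zero polynomial
  have hinf : Set.Infinite {t : ℂ | Q.IsRoot t} := by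
    refine Set.Infinite.mono (fun t (ht : t ∈ ({0}ᶜ : Set ℂ)) => hroot t ht) ?_
    exact (Set.finite_singleton (0 : ℂ)).infinite_compl
  have hQ : Q = 0 := Polynomial.eq_zero_of_infinite_isRoot Q hinf
  -- and evaluating at `t = 0` gives the claim
  have h0 := ZariskiLimit.eval_aeval_coordPoly P E p 0
  rw [ZariskiLimit.curve_zero, ← hQdef, hQ, Polynomial.eval_zero] at h0
  exact h0.symm

end Summit.ValiantsHypothesis.ValiantsHypothesis.Theorems.DetQPDetqpSuperquadratic
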